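import Mathlib.Analysis.Convolution
import Mathlib.Analysis.Distribution.SchwartzSpace.Deriv
import Mathlib.MeasureTheory.Integral.IntegralEqImproper
import Mathlib.MeasureTheory.Function.L2Space
import Mathlib.MeasureTheory.Group.Integral
import Mathlib.MeasureTheory.Measure.Haar.NormedSpace
import Literature.Analysis.UnboundedOperators.UnitaryRepProofs
import Literature.Analysis.UnboundedOperators.StrongContRepresentationProofs
import HarnessLib

/-!
# Smeared operators `∫ k(a) U(a) da` of a one-parameter unitary group

Topic `Literature/Analysis/UnboundedOperators`, proofs layer over items C3/C4
(`StrongContRepresentation`, `UnitaryRep`). For a strongly continuous one-parameter unitary group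
`U(t) = exp (tA) = exp (itH)` on a Hilbert space and an integrable kernel `k : ℝ → ℂ` we study the
*smeared* (Bochner-integrated) vectors

  `U[k] ψ := ∫ k(a) • U(a) ψ da`,

the operators `∫ ρ(a) U(a, 1) da` through which Streater–Wightman formulate the spectral condition
(*PCT, Spin and Statistics, and All That*, §2-6, discussion of (2-113)–(2-114): "a set `S` is not in
the energy–momentum spectrum iff `∫ da ρ(a) U(a, 1) = ∫ ρ̃(p) dE(p) = 0` for all `ρ ∈ 𝒮` with
`supp ρ̃ ⊆ S`"), and which in the `C*`-literature define the Arveson spectrum of a group action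
(Pedersen, *C\*-algebras and their automorphism groups* (1979), §8.1; Bratteli–Robinson I, §3.2.3).
Everything is elementary Bochner-integral calculus; no spectral theorem is used:

* `integrable_smul_appReal`, `norm_integral_smul_appReal_le`: `U[k]ψ` exists, `‖U[k]ψ‖ ≤ ‖k‖₁ ‖ψ‖`;
* `inner_integral_smul_appReal`: `⟪φ, U[k]ψ⟫ = ∫ k(a) ⟪φ, U(a)ψ⟫ da` (the matrix coefficients);
* `inner_integral_smul_appReal_left`: `U[k]* = U[k†]`, `k†(a) = conj k(-a)`;
* `appReal_apply_integral_smul_appReal`: `U(t) U[k] = U[k(· - t)]`;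
* `integral_smul_appReal_integral_smul_appReal`: `U[k₁] U[k₂] = U[k₁ ⋆ k₂]` (Fubini);
* `exists_clm_integral_smul_appReal`: `ψ ↦ U[k]ψ` is a bounded operator;
* `hasDerivAt_appReal_apply`: for `x ∈ D(A)` the orbit is `C¹` with `d/dt U(t)x = U(t)Ax`
  (Reed–Simon I, Thm. VIII.7 (c));
* `integral_smul_appReal_mem_generator_domain`: `U[k] D(A) ⊆ D(A)` and `A U[k] x = U[k] A x`;
* `integral_smul_appReal_generator_eq_neg`: `U[k] A x = -U[k'] x` for Schwartz `k`
  (integration by parts on `ℝ`);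
* `tendsto_integral_dilate_smul_appReal`: `U[R k(R ·)] x → (∫ k) • x` as `R → ∞`
  (approximate identities);
* `inner_integral_smul_appReal_eq_zero_of_mem_invariantVectors`,
  `mem_closure_generator_domain_inter_orthogonal`: smearing and orbit averages preserve
  orthogonality to an invariant vector, so `D(A) ∩ {Ω}ᗮ` is dense in `{Ω}ᗮ`.

## References

* R. F. Streater, A. S. Wightman, *PCT, Spin and Statistics, and All That*, §2-6 (pp. 91–92 of the
  1964/2000 editions), eqs. (2-113)–(2-114). [StreaterWightman1964]
* M. Reed, B. Simon, *Methods of Modern Mathematical Physics I*, §VIII.4, Thm. VIII.7.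
  [ReedSimonI1980]
* K.-J. Engel, R. Nagel, *One-Parameter Semigroups for Linear Evolution Equations*, Ch. II
  Lemma 1.3. [EngelNagel2000]

## Design notes

* No definitions: the smeared vector is always written `∫ a, k a • U.appReal a ψ`; a bundled
  bounded operator is provided existentially (`exists_clm_integral_smul_appReal`) where a `CLM` is
  convenient (derivatives through the operator, continuity in `ψ`).
* Kernels are `k : ℝ → ℂ` with `Integrable k`; the integration-by-parts lemma takes a Schwartz
  kernel `k : 𝓢(ℝ, ℂ)`.
-/

noncomputable section

open Filter MeasureTheory Complex
open scoped InnerProductSpace Topology ComplexConjugate SchwartzMap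

namespace Literature.Analysis.UnboundedOperators

namespace UnitaryRep

variable {H : Type*} [NormedAddCommGroup H] [InnerProductSpace ℂ H] [CompleteSpace H]

/-! ### Existence, bound, matrix coefficients -/

/-- `‖k(a) • U(a)ψ‖ = ‖k(a)‖ ‖ψ‖` (unitarity). [folklore] -/
theorem norm_smul_appReal (U : OneParameterUnitaryGroup H) (k : ℝ → ℂ) (ψ : H) (a : ℝ) :
    ‖k a • U.appReal a ψ‖ = ‖k a‖ * ‖ψ‖ := by
  rw [norm_smul, norm_appReal]

/-- For integrable `k`, the smeared orbit `a ↦ k(a) • U(a)ψ` is Bochner integrable (its norm is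
`‖k(a)‖ ‖ψ‖`; Streater–Wightman §2-6, the operators `∫ ρ(a) U(a,1) da`). [folklore] -/
theorem integrable_smul_appReal (U : OneParameterUnitaryGroup H) {k : ℝ → ℂ} (hk : Integrable k)
    (ψ : H) : Integrable fun a => k a • U.appReal a ψ := by
  refine (hk.norm.mul_const ‖ψ‖).mono'
    (hk.aestronglyMeasurable.smul (U.continuous_appReal_apply ψ).aestronglyMeasurable)
    (Eventually.of_forall fun a => ?_)
  rw [norm_smul_appReal]

/-- `‖∫ k(a) • U(a)ψ da‖ ≤ ‖k‖₁ ‖ψ‖`. [folklore] -/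
theorem norm_integral_smul_appReal_le (U : OneParameterUnitaryGroup H) (k : ℝ → ℂ) (ψ : H) :
    ‖∫ a, k a • U.appReal a ψ‖ ≤ (∫ a, ‖k a‖) * ‖ψ‖ := by
  calc ‖∫ a, k a • U.appReal a ψ‖ ≤ ∫ a, ‖k a • U.appReal a ψ‖ := norm_integral_le_integral_norm _
    _ = ∫ a, ‖k a‖ * ‖ψ‖ := by simp_rw [norm_smul_appReal]
    _ = (∫ a, ‖k a‖) * ‖ψ‖ := integral_mul_const _ _

/-- **Matrix coefficients of a smeared vector**: `⟪φ, ∫ k(a) • U(a)ψ da⟫ = ∫ k(a) ⟪φ, U(a)ψ⟫ da`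
(Streater–Wightman §2-6, passage from `∫ ρ(a) U(a,1) da = 0` to `∫ ρ(a) (Φ, U(a,1)Ψ) da = 0`).
[cite: StreaterWightman1964, §2-6 eqs. (2-113)–(2-114)] -/
theorem inner_integral_smul_appReal (U : OneParameterUnitaryGroup H) {k : ℝ → ℂ}
    (hk : Integrable k) (φ ψ : H) :
    ⟪φ, ∫ a, k a • U.appReal a ψ⟫_ℂ = ∫ a, k a * ⟪φ, U.appReal a ψ⟫_ℂ := by
  rw [← integral_inner (U.integrable_smul_appReal hk ψ)]
  simp_rw [inner_smul_right]

/-- Additivity of smearing in the vector. [folklore] -/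
theorem integral_smul_appReal_add (U : OneParameterUnitaryGroup H) {k : ℝ → ℂ} (hk : Integrable k)
    (ψ₁ ψ₂ : H) :
    ∫ a, k a • U.appReal a (ψ₁ + ψ₂) =
      (∫ a, k a • U.appReal a ψ₁) + ∫ a, k a • U.appReal a ψ₂ := by
  rw [← integral_add (U.integrable_smul_appReal hk ψ₁) (U.integrable_smul_appReal hk ψ₂)]
  simp_rw [map_add, smul_add]

/-- Homogeneity of smearing in the vector. [folklore] -/
theorem integral_smul_appReal_smul (U : OneParameterUnitaryGroup H) (k : ℝ → ℂ) (c : ℂ) (ψ : H) :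
    ∫ a, k a • U.appReal a (c • ψ) = c • ∫ a, k a • U.appReal a ψ := by
  rw [← integral_smul]
  simp_rw [map_smul, smul_comm (k _) c]

/-- Smearing is subtractive in the vector. [folklore] -/
theorem integral_smul_appReal_sub (U : OneParameterUnitaryGroup H) {k : ℝ → ℂ} (hk : Integrable k)
    (ψ₁ ψ₂ : H) :
    ∫ a, k a • U.appReal a (ψ₁ - ψ₂) =
      (∫ a, k a • U.appReal a ψ₁) - ∫ a, k a • U.appReal a ψ₂ := by
  rw [← integral_sub (U.integrable_smul_appReal hk ψ₁) (U.integrable_smul_appReal hk ψ₂)]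
  simp_rw [map_sub, smul_sub]

/-- Additivity of smearing in the kernel. [folklore] -/
theorem integral_add_smul_appReal (U : OneParameterUnitaryGroup H) {k₁ k₂ : ℝ → ℂ}
    (hk₁ : Integrable k₁) (hk₂ : Integrable k₂) (ψ : H) :
    ∫ a, (k₁ a + k₂ a) • U.appReal a ψ =
      (∫ a, k₁ a • U.appReal a ψ) + ∫ a, k₂ a • U.appReal a ψ := by
  rw [← integral_add (U.integrable_smul_appReal hk₁ ψ) (U.integrable_smul_appReal hk₂ ψ)]
  simp_rw [add_smul]

/-- **The smeared operator is bounded**: `ψ ↦ ∫ k(a) • U(a)ψ da` is a continuous linear map of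
norm `≤ ‖k‖₁` (stated existentially; no new definition). [folklore] -/
theorem exists_clm_integral_smul_appReal (U : OneParameterUnitaryGroup H) {k : ℝ → ℂ}
    (hk : Integrable k) :
    ∃ S : H →L[ℂ] H, ∀ ψ, S ψ = ∫ a, k a • U.appReal a ψ := by
  refine ⟨LinearMap.mkContinuous
    { toFun := fun ψ => ∫ a, k a • U.appReal a ψ
      map_add' := U.integral_smul_appReal_add hk
      map_smul' := fun c ψ => U.integral_smul_appReal_smul k c ψ } (∫ a, ‖k a‖)
    (fun ψ => U.norm_integral_smul_appReal_le k ψ), fun ψ => rfl⟩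

/-- Continuity of smearing in the vector. [folklore] -/
theorem continuous_integral_smul_appReal (U : OneParameterUnitaryGroup H) {k : ℝ → ℂ}
    (hk : Integrable k) : Continuous fun ψ : H => ∫ a, k a • U.appReal a ψ := by
  obtain ⟨S, hS⟩ := U.exists_clm_integral_smul_appReal hk
  simp_rw [← hS]
  exact S.continuous

/-! ### Adjoint and translation -/

/-- The reflected conjugate kernel `k†(a) = conj k(-a)` is integrable. [folklore] -/
theorem integrable_conj_comp_neg {k : ℝ → ℂ} (hk : Integrable k) :
    Integrable fun a : ℝ => conj (k (-a)) := by
  refine (hk.comp_neg.norm).mono'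
    (continuous_conj.comp_aestronglyMeasurable hk.comp_neg.aestronglyMeasurable)
    (Eventually.of_forall fun a => ?_)
  rw [RCLike.norm_conj]

/-- **Adjoint of a smeared operator**: `⟪∫ k(a) • U(a)φ da, ψ⟫ = ⟪φ, ∫ conj k(-a) • U(a)ψ da⟫`,
i.e. `U[k]* = U[k†]` with `k†(a) = conj k(-a)` (`U(a)* = U(-a)`). [folklore] -/
theorem inner_integral_smul_appReal_left (U : OneParameterUnitaryGroup H) {k : ℝ → ℂ}
    (hk : Integrable k) (φ ψ : H) :
    ⟪∫ a, k a • U.appReal a φ, ψ⟫_ℂ = ⟪φ, ∫ a, conj (k (-a)) • U.appReal a ψ⟫_ℂ := by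
  rw [← inner_conj_symm, inner_integral_smul_appReal U hk, ← integral_conj,
    inner_integral_smul_appReal U (integrable_conj_comp_neg hk)]
  rw [← integral_neg_eq_self (fun a => conj (k (-a)) * ⟪φ, U.appReal a ψ⟫_ℂ)]
  refine integral_congr_ae (Eventually.of_forall fun a => ?_)
  simp only [map_mul, inner_conj_symm, neg_neg, inner_appReal_left]

/-- **Translation of a smeared vector**: `U(t) ∫ k(a) • U(a)ψ da = ∫ k(a - t) • U(a)ψ da`
(translation invariance of Lebesgue measure). [folklore] -/
theorem appReal_apply_integral_smul_appReal (U : OneParameterUnitaryGroup H) {k : ℝ → ℂ}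
    (hk : Integrable k) (ψ : H) (t : ℝ) :
    U.appReal t (∫ a, k a • U.appReal a ψ) = ∫ a, k (a - t) • U.appReal a ψ := by
  rw [← (U.appReal t).integral_comp_comm (U.integrable_smul_appReal hk ψ)]
  rw [← integral_add_right_eq_self (fun a => k (a - t) • U.appReal a ψ) t]
  refine integral_congr_ae (Eventually.of_forall fun a => ?_)
  simp only [map_smul, add_sub_cancel_right]
  rw [← mul_apply_eq_comp, ← appReal_add, add_comm]

/-- Smeared operators commute with the group: `U(t) ∫ k(a) • U(a)ψ da = ∫ k(a) • U(a) (U(t)ψ) da`.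
[folklore] -/
theorem appReal_apply_integral_smul_appReal' (U : OneParameterUnitaryGroup H) {k : ℝ → ℂ}
    (hk : Integrable k) (ψ : H) (t : ℝ) :
    U.appReal t (∫ a, k a • U.appReal a ψ) = ∫ a, k a • U.appReal a (U.appReal t ψ) := by
  rw [← (U.appReal t).integral_comp_comm (U.integrable_smul_appReal hk ψ)]
  refine integral_congr_ae (Eventually.of_forall fun a => ?_)
  simp only [map_smul]
  rw [← mul_apply_eq_comp, ← mul_apply_eq_comp,
    ← appReal_add, ← appReal_add, add_comm]

/-! ### Products: `U[k₁] U[k₂] = U[k₁ ⋆ k₂]` -/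

/-- **Product of smeared operators**:
`∫ k₁(a) • U(a) (∫ k₂(b) • U(b)ψ db) da = ∫ (∫ k₁(t) k₂(s - t) dt) • U(s)ψ ds`, i.e.
`U[k₁] U[k₂] = U[k₁ ⋆ k₂]` (group law, translation invariance and Fubini). [folklore] -/
theorem integral_smul_appReal_integral_smul_appReal (U : OneParameterUnitaryGroup H)
    {k₁ k₂ : ℝ → ℂ} (hk₁ : Integrable k₁) (hk₂ : Integrable k₂) (ψ : H) :
    ∫ a, k₁ a • U.appReal a (∫ b, k₂ b • U.appReal b ψ) =
      ∫ s, (∫ t, k₁ t * k₂ (s - t)) • U.appReal s ψ := by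
  -- the integrand `(t, s) ↦ k₁ t k₂ (s - t) • U(s) ψ` is integrable on `ℝ × ℝ`
  have hG : Integrable (fun p : ℝ × ℝ => k₁ p.2 * k₂ (p.1 - p.2)) (volume.prod volume) :=
    hk₁.convolution_integrand (ContinuousLinearMap.mul ℂ ℂ) hk₂
  have hF : Integrable (fun p : ℝ × ℝ => (k₁ p.1 * k₂ (p.2 - p.1)) • U.appReal p.2 ψ)
      (volume.prod volume) := by
    have hG' := hG.swap
    refine (hG'.norm.mul_const ‖ψ‖).mono'
      (hG'.aestronglyMeasurable.smul
        ((U.continuous_appReal_apply ψ).comp continuous_snd).aestronglyMeasurable)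
      (Eventually.of_forall fun p => ?_)
    simp only [Function.comp_apply, Prod.fst_swap, Prod.snd_swap]
    rw [norm_smul, norm_appReal]
  calc ∫ a, k₁ a • U.appReal a (∫ b, k₂ b • U.appReal b ψ)
      = ∫ a, ∫ b, (k₁ a * k₂ (b - a)) • U.appReal b ψ := by
        refine integral_congr_ae (Eventually.of_forall fun a => ?_)
        simp only
        rw [U.appReal_apply_integral_smul_appReal hk₂ ψ a, ← integral_smul]
        simp_rw [smul_smul]
    _ = ∫ b, ∫ a, (k₁ a * k₂ (b - a)) • U.appReal b ψ :=
        integral_integral_swap (f := fun a b => (k₁ a * k₂ (b - a)) • U.appReal b ψ) hF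
    _ = ∫ s, (∫ t, k₁ t * k₂ (s - t)) • U.appReal s ψ := by
        refine integral_congr_ae (Eventually.of_forall fun b => ?_)
        simp only
        rw [integral_smul_const]

/-! ### Differentiable orbits, the generator, integration by parts -/

/-- **Orbits of `D(A)` are continuously differentiable**: for `x ∈ D(A)` and every real `a`,
`d/dt U(t) x |_{t = a} = U(a) A x` (two-sided derivative; Reed–Simon I, Thm. VIII.7 (c); the
two-sided difference quotient at `0` is `OneParameterGroup.tendsto_generator_two_sided`, and
`U(t) x = U(a) U(t - a) x`). [cite: ReedSimonI1980, Thm VIII.7 (c)] -/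
theorem hasDerivAt_appReal_apply (U : OneParameterUnitaryGroup H)
    (x : (OneParameterGroup.generator U.toStrongContRepresentation).domain) (a : ℝ) :
    HasDerivAt (fun t : ℝ => U.appReal t (x : H))
      (U.appReal a (OneParameterGroup.generator U.toStrongContRepresentation x)) a := by
  -- derivative at `0`
  have h0 : HasDerivAt (fun t : ℝ => U.appReal t (x : H))
      (OneParameterGroup.generator U.toStrongContRepresentation x : H) 0 := by
    rw [hasDerivAt_iff_tendsto_slope]
    refine (OneParameterGroup.tendsto_generator_two_sided_holds U.toStrongContRepresentation
      x).congr' (Eventually.of_forall fun t => ?_)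
    rw [slope_def_module, sub_zero, appReal_zero, one_apply_eq_self,
      RCLike.real_smul_eq_coe_smul (K := ℂ), app_toStrongContRepresentation]
  -- shift to `a`
  have h1 : HasDerivAt (fun t : ℝ => U.appReal (t - a) (x : H))
      (OneParameterGroup.generator U.toStrongContRepresentation x : H) a := by
    have := h0
    rw [← sub_self a] at this
    exact this.comp_sub_const a a
  have h2 := ((U.appReal a).restrictScalars ℝ).hasFDerivAt.comp_hasDerivAt a h1
  refine h2.congr_of_eventuallyEq (Eventually.of_forall fun t => ?_)
  simp only [Function.comp_apply, ContinuousLinearMap.coe_restrictScalars']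
  rw [← mul_apply_eq_comp, ← appReal_add, add_sub_cancel]

/-- **Smeared operators preserve `D(A)` and commute with `A`**: for `x ∈ D(A)` and integrable `k`,
`∫ k(a) • U(a)x da ∈ D(A)` and `A ∫ k(a) • U(a)x da = ∫ k(a) • U(a)(A x) da` (the smeared operator is
bounded and commutes with every `U(t)`; Reed–Simon I, Thm. VIII.7). [cite: ReedSimonI1980, Thm VIII.7] -/
theorem integral_smul_appReal_mem_generator_domain (U : OneParameterUnitaryGroup H) {k : ℝ → ℂ}
    (hk : Integrable k) (x : (OneParameterGroup.generator U.toStrongContRepresentation).domain) :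
    ∃ h : (∫ a, k a • U.appReal a (x : H)) ∈
        (OneParameterGroup.generator U.toStrongContRepresentation).domain,
      OneParameterGroup.generator U.toStrongContRepresentation ⟨_, h⟩ =
        ∫ a, k a • U.appReal a (OneParameterGroup.generator U.toStrongContRepresentation x) := by
  obtain ⟨S, hS⟩ := U.exists_clm_integral_smul_appReal hk
  apply OneParameterGroup.mem_generator_domain_of_hasDerivAt
  have h0 := U.hasDerivAt_appReal_apply x 0
  rw [appReal_zero, one_apply_eq_self] at h0
  have h1 := (S.restrictScalars ℝ).hasFDerivAt.comp_hasDerivAt 0 h0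
  refine (h1.congr_of_eventuallyEq (Eventually.of_forall fun t => ?_)).congr_deriv ?_
  · simp only [Function.comp_apply, ContinuousLinearMap.coe_restrictScalars',
      app_toStrongContRepresentation, hS]
    exact U.appReal_apply_integral_smul_appReal' hk x t
  · simp only [ContinuousLinearMap.coe_restrictScalars', hS]

/-- **Integration by parts against an orbit**: for a Schwartz kernel `k` and `x ∈ D(A)`,
`∫ k(a) • U(a)(A x) da = -∫ k'(a) • U(a)x da` (`d/da U(a)x = U(a)Ax` and integration by parts on
`(-∞, ∞)`, Mathlib's `integral_bilinear_hasDerivAt_right_eq_neg_left_of_integrable`). [folklore] -/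
theorem integral_smul_appReal_generator_eq_neg (U : OneParameterUnitaryGroup H) (k : 𝓢(ℝ, ℂ))
    (x : (OneParameterGroup.generator U.toStrongContRepresentation).domain) :
    ∫ a, k a • U.appReal a (OneParameterGroup.generator U.toStrongContRepresentation x) =
      -∫ a, deriv k a • U.appReal a (x : H) := by
  have hdk : Integrable (deriv (k : ℝ → ℂ)) := (SchwartzMap.derivCLM ℝ ℂ k).integrable
  have := integral_bilinear_hasDerivAt_right_eq_neg_left_of_integrable
    (L := ContinuousLinearMap.lsmul ℝ ℂ (E := H))
    (u := (k : ℝ → ℂ)) (u' := deriv (k : ℝ → ℂ)) (v := fun a => U.appReal a (x : H))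
    (v' := fun a => U.appReal a (OneParameterGroup.generator U.toStrongContRepresentation x))
    (fun a _ => k.hasDerivAt a) (fun a _ => U.hasDerivAt_appReal_apply x a)
    (by
      simpa using U.integrable_smul_appReal k.integrable
        (OneParameterGroup.generator U.toStrongContRepresentation x))
    (by simpa using U.integrable_smul_appReal hdk (x : H))
    (by simpa using U.integrable_smul_appReal k.integrable (x : H))
  simpa using this

/-! ### Approximate identities -/

/-- **Approximate identity**: for integrable `k`, `∫ R k(R a) • U(a)x da → (∫ k) • x` as `R → ∞`
(substitute `a = b / R` and use strong continuity under the integral sign, dominated by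
`‖k(b)‖ ‖x‖`). [folklore] -/
theorem tendsto_integral_dilate_smul_appReal (U : OneParameterUnitaryGroup H) {k : ℝ → ℂ}
    (hk : Integrable k) (x : H) :
    Tendsto (fun R : ℝ => ∫ a, ((R : ℂ) * k (R * a)) • U.appReal a x) atTop
      (𝓝 ((∫ a, k a) • x)) := by
  -- substitution `b = R a` for `R > 0`
  have key : ∀ R : ℝ, 0 < R →
      ∫ a, ((R : ℂ) * k (R * a)) • U.appReal a x = ∫ b, k b • U.appReal (R⁻¹ * b) x := by
    intro R hR
    have h := Measure.integral_comp_mul_left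
      (fun b => ((R : ℂ) * k b) • U.appReal (R⁻¹ * b) x) R
    simp only [inv_mul_cancel_left₀ hR.ne'] at h
    rw [h, abs_of_pos (inv_pos.mpr hR), ← integral_smul]
    refine integral_congr_ae (Eventually.of_forall fun b => ?_)
    simp only
    rw [← Complex.coe_smul, smul_smul, ← mul_assoc, Complex.ofReal_inv,
      inv_mul_cancel₀ (Complex.ofReal_ne_zero.mpr hR.ne'), one_mul]
  -- dominated convergence as `R → ∞`
  have hlim : Tendsto (fun R : ℝ => ∫ b, k b • U.appReal (R⁻¹ * b) x) atTop
      (𝓝 (∫ b, k b • x)) := by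
    refine tendsto_integral_filter_of_dominated_convergence (fun b => ‖k b‖ * ‖x‖) ?_ ?_
      (hk.norm.mul_const ‖x‖) ?_
    · refine Eventually.of_forall fun R => ?_
      exact hk.aestronglyMeasurable.smul
        ((U.continuous_appReal_apply x).comp (continuous_const.mul continuous_id)).aestronglyMeasurable
    · refine Eventually.of_forall fun R => Eventually.of_forall fun b => ?_
      rw [norm_smul, norm_appReal]
    · refine Eventually.of_forall fun b => ?_
      have hc : Continuous fun s : ℝ => k b • U.appReal s x := by fun_prop
      have h0 : Tendsto (fun R : ℝ => R⁻¹ * b) atTop (𝓝 0) := by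
        simpa using tendsto_inv_atTop_zero.mul_const b
      have h1 : Tendsto (fun s : ℝ => k b • U.appReal s x) (𝓝 0) (𝓝 (k b • x)) := by
        have := hc.tendsto 0
        rwa [appReal_zero, one_apply_eq_self] at this
      exact h1.comp h0
  rw [integral_smul_const] at hlim
  refine hlim.congr' ?_
  filter_upwards [eventually_gt_atTop 0] with R hR
  exact (key R hR).symm

/-- Approximate identity, kernel dilated as `a ↦ R k(a R)`. [folklore] -/
theorem tendsto_integral_dilate_smul_appReal' (U : OneParameterUnitaryGroup H) {k : ℝ → ℂ}
    (hk : Integrable k) (x : H) :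
    Tendsto (fun R : ℝ => ∫ a, ((R : ℂ) * k (a * R)) • U.appReal a x) atTop
      (𝓝 ((∫ a, k a) • x)) := by
  have : (fun R : ℝ => ∫ a, ((R : ℂ) * k (a * R)) • U.appReal a x) =
      fun R : ℝ => ∫ a, ((R : ℂ) * k (R * a)) • U.appReal a x := by
    funext R
    simp_rw [mul_comm _ R]
  rw [this]
  exact U.tendsto_integral_dilate_smul_appReal hk x

/-! ### Orthogonality to invariant vectors -/

/-- Matrix coefficients against an invariant vector are constant: `⟪Ω, U(a)ψ⟫ = ⟪Ω, ψ⟫`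
(`U(a)* Ω = U(-a) Ω = Ω`). [folklore] -/
theorem inner_appReal_apply_of_mem_invariantVectors (U : OneParameterUnitaryGroup H) {Ω : H}
    (hΩ : Ω ∈ U.invariantVectors) (ψ : H) (a : ℝ) :
    ⟪Ω, U.appReal a ψ⟫_ℂ = ⟪Ω, ψ⟫_ℂ := by
  rw [inner_appReal_right]
  have : U.appReal (-a) Ω = Ω := (mem_invariantVectors_iff U Ω).mp hΩ (Multiplicative.ofAdd (-a))
  rw [this]

/-- **Smearing preserves orthogonality to an invariant vector**: if `U(t)Ω = Ω` for all `t` and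
`⟪Ω, ψ⟫ = 0`, then `⟪Ω, ∫ k(a) • U(a)ψ da⟫ = 0` (the subspace `{Ω}ᗮ` reduces every `U(a)`,
Streater–Wightman §3-1, states orthogonal to the vacuum). [folklore] -/
theorem inner_integral_smul_appReal_eq_zero_of_mem_invariantVectors (U : OneParameterUnitaryGroup H)
    {k : ℝ → ℂ} (hk : Integrable k) {Ω ψ : H} (hΩ : Ω ∈ U.invariantVectors)
    (hψ : ⟪Ω, ψ⟫_ℂ = 0) :
    ⟪Ω, ∫ a, k a • U.appReal a ψ⟫_ℂ = 0 := by
  rw [inner_integral_smul_appReal U hk]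
  simp [U.inner_appReal_apply_of_mem_invariantVectors hΩ, hψ]

/-- **`D(A) ∩ {Ω}ᗮ` is dense in `{Ω}ᗮ`** for an invariant vector `Ω`: the orbit averages
`t⁻¹ ∫₀ᵗ U(s)ψ ds ∈ D(A)` (Engel–Nagel Thm. II.1.4) stay orthogonal to `Ω` and converge to `ψ`.
[cite: EngelNagel2000, Ch. II Thm. 1.4] -/
theorem mem_closure_generator_domain_inter_orthogonal (U : OneParameterUnitaryGroup H) {Ω ψ : H}
    (hΩ : Ω ∈ U.invariantVectors) (hψ : ⟪Ω, ψ⟫_ℂ = 0) :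
    ψ ∈ closure {η : H |
      η ∈ (OneParameterGroup.generator U.toStrongContRepresentation).domain ∧ ⟪Ω, η⟫_ℂ = 0} := by
  have ht := OneParameterGroup.tendsto_inv_smul_integral_app U.toStrongContRepresentation ψ
  refine mem_closure_of_tendsto ht (Eventually.of_forall fun t => ⟨?_, ?_⟩)
  · rw [RCLike.real_smul_eq_coe_smul (K := ℂ)]
    exact Submodule.smul_mem _ _
      (OneParameterGroup.integral_mem_generator_domain U.toStrongContRepresentation ψ t).1
  · rw [RCLike.real_smul_eq_coe_smul (K := ℂ), inner_smul_right]
    simp only [app_toStrongContRepresentation]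
    rw [inner_integral_appReal]
    simp [U.inner_appReal_apply_of_mem_invariantVectors hΩ, hψ]

end UnitaryRep

end Literature.Analysis.UnboundedOperators
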